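import Literature.AnabelianGeometry.SemiGraphs.Prop36HypothesesWitnessLevelDictionary
import Literature.AnabelianGeometry.SemiGraphs.TemperedCompactInVerticialOfGoodDictionary

/-!
# The good-conjugator level dictionary `GoodLevelDictionary` is instantiable — with its three obligations — at the Prop. 3.6 / Thm. 3.7 witness

Mochizuki, *Semi-graphs of anabelioids*, Publ. RIMS **42** (2006) [MochizukiSemiAnbd2006], Thm. 3.7
(iii) pp. 264–265 (kurims pp. 40–41) and its proof with the author's *Comments* (2020) (6)(b); Rmk.
2.2.1 p. 248 (kurims p. 24); Def. 2.2 (i) p. 247 (kurims p. 23).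

KERNEL CERTIFICATE (cell abc-iut, layer L3, row NV-L3/GoodLevelDictionary of the inhabitation census
INHABITATION-CENSUS-L3-v1 §A1; seat abc-iut-w5-d212 gen 3).  abc-iut-L3-t10's interface
`ProfiniteSemiGraph.GoodLevelDictionary` (`TemperedLevelDictionaryGood.lean`, row «LD-REPAIR» (B′):
the per-level branch dictionary with COVERING kernels `M_j` and GOOD conjugator sets `good j w`,
rulings α5-1/α8-2 of abc-iut-L3-lead) had no producer in the tree.  This file instantiates it at the
edgeless one-vertex witness `affWitness p` over the explicit chart `affChart p`
(`π₁^temp = Aff(ℤ_p)`), with the SAME tree/level/overgroup data as the covering dictionary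
`affCovLevelDictionary p` of `Prop36HypothesesWitnessLevelDictionary.lean` (levels and trees the
point graph, all actions trivial, `Q := Aff(ℤ_p)`, `ι_Q = ψ_v = id`, `M_j := Γ_j` the congruence
subgroups — open, normal, antitone, `⋂_j Γ_j = 1`) and the good conjugator sets `good j w := Q`
(print: `{γ | γ · w₀ = w}`; here every `γ` fixes the unique level vertex), which are nonempty,
closed and decreasing.  The three single-level obligations (DB′) (DI′) (DN′) are branch-indexed and
therefore hold at the witness (no branches): `affGoodLevelDictionary_DB/_DI/_DN`.  Hence the glue
`GoodLevelDictionary.toFiniteLevelData` is inhabited (`affGoodFiniteLevelData`), and abc-iut-L3-t10's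
consumer `FiniteLevelData.compactInVerticial_of_goodLevelDictionary` RUNS END-TO-END on a concrete
object: both conjuncts of `CompactInVerticial` at EVERY chart of the witness
(`compactInVerticial_chart_affWitness_of_goodLevelDictionary`).  So the repaired (B′) interface
together with its three obligations is CONSISTENT (simultaneously satisfiable).  HONEST LABEL:
degenerate (one vertex, no edges) — a witness certifies consistency / non-vacuity only and says
nothing about graphs with edges; no statement of the paper is touched, strengthened or assumed.
Nothing here takes a side on [IUTchIII] Cor. 3.12.
-/

noncomputable section

namespace Literature.AnabelianGeometry.SemiGraphs

namespace ProfiniteSemiGraph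

open CategoryTheory Topology Literature.GroupTheory.SpecificGroups

variable {p : ℕ} [Fact p.Prime]

/-! ### The dictionary -/

variable (p) in
/-- **The good-conjugator level dictionary of the witness** over the explicit chart `affChart p`
(`π₁^temp = Aff(ℤ_p)`): the tree-level data, finite levels, structure maps, compact overgroup
`Q := Aff(ℤ_p)` (`ι_Q = id`), covering kernels `M_j := Γ_j`, reference embeddings `ψ_v = id` and
(absent) branch representatives of the covering dictionary `affCovLevelDictionary p`, together with
the good conjugator sets `good j w := Q` (every element of `Q` carries the reference vertex `w₀`
to the unique level vertex `w`). [cite: MochizukiSemiAnbd2006, Rmk. 2.2.1 p.24] -/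
def affGoodLevelDictionary : GoodLevelDictionary.{0} (affWitness p) (affChart p) where
  toVerticialLevelData := (affCovLevelDictionary p).toVerticialLevelData
  level := (affCovLevelDictionary p).level
  finiteVertex := (affCovLevelDictionary p).finiteVertex
  finiteBranch := (affCovLevelDictionary p).finiteBranch
  quot := (affCovLevelDictionary p).quot
  quot_isImmersion := (affCovLevelDictionary p).quot_isImmersion
  levelAct := (affCovLevelDictionary p).levelAct
  act_quot := (affCovLevelDictionary p).act_quot
  levelTrans := (affCovLevelDictionary p).levelTrans
  levelTrans_id := (affCovLevelDictionary p).levelTrans_id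
  levelTrans_comp := (affCovLevelDictionary p).levelTrans_comp
  levelTrans_act := (affCovLevelDictionary p).levelTrans_act
  trans_quot := (affCovLevelDictionary p).trans_quot
  levelProj := (affCovLevelDictionary p).levelProj
  levelProj_trans := (affCovLevelDictionary p).levelProj_trans
  Q := (affCovLevelDictionary p).Q
  ιQ := (affCovLevelDictionary p).ιQ
  ιQ_injective := (affCovLevelDictionary p).ιQ_injective
  qAct := (affCovLevelDictionary p).qAct
  qAct_ιQ := (affCovLevelDictionary p).qAct_ιQ
  M := (affCovLevelDictionary p).M
  M_normal := (affCovLevelDictionary p).M_normal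
  isOpen_M := (affCovLevelDictionary p).isOpen_M
  M_anti := (affCovLevelDictionary p).M_anti
  M_trivial := (affCovLevelDictionary p).M_trivial
  ψ := (affCovLevelDictionary p).ψ
  ψ_injective := (affCovLevelDictionary p).ψ_injective
  ψ_continuous := (affCovLevelDictionary p).ψ_continuous
  rep := (affCovLevelDictionary p).rep
  good := fun _ _ => Set.univ
  good_nonempty := fun _ _ => Set.univ_nonempty
  good_isClosed := fun _ _ => isClosed_univ
  good_anti := fun _ _ _ _ => Set.subset_univ _

/-- The good dictionary and the covering dictionary of the witness share their tree-level data
(definitionally). [cite: MochizukiSemiAnbd2006, Rmk. 2.2.1 p.24] -/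
theorem affGoodLevelDictionary_toVerticialLevelData :
    (affGoodLevelDictionary p).toVerticialLevelData = (affCovLevelDictionary p).toVerticialLevelData :=
  rfl

/-- The compact overgroup of the good dictionary is `Aff(ℤ_p)` (definitionally).
[cite: MochizukiSemiAnbd2006, Rmk. 2.2.1 p.24] -/
theorem affGoodLevelDictionary_Q : (affGoodLevelDictionary p).Q = PadicAffine p := rfl

/-- The covering kernels of the good dictionary are the congruence subgroups (definitionally).
[cite: MochizukiSemiAnbd2006, Rmk. 2.2.1 p.24] -/
theorem affGoodLevelDictionary_M (j : ℕ) :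
    (affGoodLevelDictionary p).M j = PadicAffine.level p j := rfl

/-- The good conjugator sets of the witness dictionary are all of `Q` (definitionally).
[cite: MochizukiSemiAnbd2006, Rmk. 2.2.1 p.24] -/
theorem affGoodLevelDictionary_good (j : ℕ) (w : ((affGoodLevelDictionary p).level j).Vertex) :
    (affGoodLevelDictionary p).good j w = Set.univ := rfl

/-! ### The three obligations hold -/

/-- **(DB′) holds** for the witness dictionary (the obligation is indexed by the branches of the
level graphs, and the levels of the witness have none). [cite: MochizukiSemiAnbd2006, Rmk. 2.2.1 p.24] -/
theorem affGoodLevelDictionary_DB : (affGoodLevelDictionary p).DB :=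
  fun _ _ _ _ _ _ β => PEmpty.elim β

/-- **(DI′) holds** for the witness dictionary (branch-indexed; no branches).
[cite: MochizukiSemiAnbd2006, Def. 2.2(i) p.23] -/
theorem affGoodLevelDictionary_DI : (affGoodLevelDictionary p).DI :=
  fun _ _ _ _ _ _ β => PEmpty.elim β

/-- **(DN′) holds** for the witness dictionary (branch-indexed; no branches).
[cite: MochizukiSemiAnbd2006, Def. 2.2(i) p.23] -/
theorem affGoodLevelDictionary_DN : (affGoodLevelDictionary p).DN :=
  fun _ _ _ _ _ _ _ _ β => PEmpty.elim β

/-! ### Consequences: the glue and Thm. 3.7 (iii) at the witness through the good-dictionary consumer -/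

variable (p) in
/-- **The glue is inhabited**: finite-level data of the explicit chart of the witness, obtained from
the GOOD dictionary through `GoodLevelDictionary.toFiniteLevelData` and the three obligations.
[cite: MochizukiSemiAnbd2006, Thm 3.7(iii) p.41] -/
def affGoodFiniteLevelData : FiniteLevelData.{0} (affWitness p) (affChart p) :=
  (affGoodLevelDictionary p).toFiniteLevelData affGoodLevelDictionary_DB affGoodLevelDictionary_DI
    affGoodLevelDictionary_DN

/-- `GoodLevelDictionary` is inhabited at the witness over its explicit chart.
[cite: MochizukiSemiAnbd2006, Thm 3.7(iii) p.41] -/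
theorem nonempty_goodLevelDictionary_affChart :
    Nonempty (GoodLevelDictionary.{0} (affWitness p) (affChart p)) :=
  ⟨affGoodLevelDictionary p⟩

/-- Non-vacuity of the repaired producer contract (B′) of the Thm. 3.7 (iii) route: some `𝒢`
satisfying the hypotheses of Thm. 3.7 has a chart with a good-conjugator level dictionary
satisfying (DB′) (DI′) (DN′) simultaneously. [cite: MochizukiSemiAnbd2006, Thm 3.7(iii) p.41] -/
theorem exists_goodLevelDictionary_obligations :
    ∃ (𝒢 : ProfiniteSemiGraph.{0}) (_ : 𝒢.Thm37Hypotheses) (c : TemperedPiChart 𝒢)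
      (X : GoodLevelDictionary.{0} 𝒢 c), X.DB ∧ X.DI ∧ X.DN :=
  ⟨@affWitness 2 ⟨Nat.prime_two⟩, @affWitness_thm37Hypotheses 2 ⟨Nat.prime_two⟩,
    @affChart 2 ⟨Nat.prime_two⟩, @affGoodLevelDictionary 2 ⟨Nat.prime_two⟩,
    @affGoodLevelDictionary_DB 2 ⟨Nat.prime_two⟩, @affGoodLevelDictionary_DI 2 ⟨Nat.prime_two⟩,
    @affGoodLevelDictionary_DN 2 ⟨Nat.prime_two⟩⟩

/-- **Thm. 3.7 (iii) at the witness, END-TO-END through the good-dictionary consumer**: both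
conjuncts of `CompactInVerticial` at EVERY chart `c` of `affWitness p` and every compact subgroup
`C`, obtained by feeding `affGoodLevelDictionary p` and its three obligations to abc-iut-L3-t10's
`FiniteLevelData.compactInVerticial_of_goodLevelDictionary`.
[cite: MochizukiSemiAnbd2006, Thm 3.7(iii) pp.40-41] -/
theorem compactInVerticial_chart_affWitness_of_goodLevelDictionary
    (c : TemperedPiChart (affWitness p)) (C : Subgroup c.G) (hC : IsCompact (C : Set c.G)) :
    (∃ (v : (affWitness p).graph.Vertex) (H : Subgroup c.G),
        H ∈ verticialSubgroups c v ∧ C ≤ H) ∧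
      (C ≠ ⊥ → ∀ (v₁ v₂ : (affWitness p).graph.Vertex) (H₁ H₂ : Subgroup c.G),
        H₁ ∈ verticialSubgroups c v₁ → H₂ ∈ verticialSubgroups c v₂ → H₁ ≠ H₂ → C ≤ H₁ → C ≤ H₂ →
          (∀ (v₃ : (affWitness p).graph.Vertex) (H₃ : Subgroup c.G),
              H₃ ∈ verticialSubgroups c v₃ → C ≤ H₃ → H₃ = H₁ ∨ H₃ = H₂) ∧
          ∃ (e : (affWitness p).graph.Edge) (L : Subgroup c.G),
            (affWitness p).graph.IsClosedEdge e ∧ L ∈ edgeLikeSubgroups c e ∧ C ≤ L) :=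
  FiniteLevelData.compactInVerticial_of_goodLevelDictionary (affGoodLevelDictionary p)
    affGoodLevelDictionary_DB affGoodLevelDictionary_DI affGoodLevelDictionary_DN
    affWitness_thm37Hypotheses c C hC

end ProfiniteSemiGraph

end Literature.AnabelianGeometry.SemiGraphs

end
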